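import Mathlib
import Summits.Ventures.HodgeRepro2.T5HeckeInducedIrreducible
import Summits.Ventures.HodgeRepro2.T5LevelIdempotentNaturality
import Summits.Ventures.HodgeRepro2.T5HeckeCommutativeMultiplicityOne

/-!
# THE SPHERICAL SUBQUOTIENT GENERATED BY A `K`-INVARIANT VECTOR

Tier-5 support N3 / §G-N4.2 (seat p3, gen 85). Let `ρ` be a representation of `G` on `V`, `K` a subgroup with
finite `K`-orbits on `G / K`, and `v₀ ≠ 0` a `K`-invariant vector such that every `K`-invariant vector of the
cyclic `G`-submodule `⟨G v₀⟩` is a multiple of `v₀`. This file builds THE IRREDUCIBLE SUBQUOTIENT OF `V`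
GENERATED BY `v₀` — the quotient of `⟨G v₀⟩` by a maximal proper `G`-stable subspace — and proves that it is
irreducible, `K`-finite, has one-dimensional `K`-invariants spanned by the image of `v₀`, and carries the same
Hecke eigenvalues as `v₀`:

* **`cyclicSpan ρ v₀ hv₀`** — the cyclic submodule `⟨G v₀⟩ = span {ρ(g) v₀}` (the range of p8's `orbitLinear`);
  `apply_mem_cyclicSpan` (stable), `mem_cyclicSpan`, **`cyclicSpan_le`** (the smallest stable submodule containing
  `v₀`); `cyclicRep` (the representation on it), `gen` (the generator), `gen_mem_invariants`;
* **`kFinite_cyclicRep`** — `⟨G v₀⟩` is `K`-finite (every vector is fixed by a finite-index subgroup of `K`):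
  the image of p8's `K`-finite permutation module;
* **`exists_maximal`** / `maximalSub` — a maximal `G`-stable subspace of `⟨G v₀⟩` not containing `v₀` (Zorn);
  `eq_top_of_gen_mem` (a stable subspace containing `v₀` is everything);
* **`sphericalQuot ρ v₀ hv₀ h0`** — the quotient representation; **`isIrreducible_sphericalQuot`**,
  `kFinite_sphericalQuot`, **`invariants_sphericalQuot_eq`** (`K`-invariants = the line through the image of
  `v₀`), `finiteDimensional_invariants_sphericalQuot`, `invariants_sphericalQuot_ne_bot`;
* **`heckeSMul_sphericalQuot_mk_gen`** — `T · [v₀] = c · [v₀]` whenever `T · v₀ = c · v₀`;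
  **`heckeCharacter_sphericalQuot`** — the Hecke character of the subquotient at `T` is that eigenvalue.

Nothing here is a statement about (P), theta lifts or L-values. §8(d): uses an L-value-free non-vanishing
device: NO.
-/

open Summit.Ventures.HodgeRepro2.T5HeckePermutationModule Summit.Ventures.HodgeRepro2.LevelPositivity
  Summit.Ventures.HodgeRepro2.T5LevelIdempotent Summit.Ventures.HodgeRepro2.T5LevelIdempotentNaturality
  Summit.Ventures.HodgeRepro2.T5HeckeInducedIrreducible Summit.Ventures.HodgeRepro2.T5HeckeInduced
  Summit.Ventures.HodgeRepro2.T5HeckeCommutativeMultiplicityOne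

namespace Summit.Ventures.HodgeRepro2.T5CyclicSubquotient

section Cyclic

variable {G : Type*} [Group G] {k : Type*} [Field k] {V : Type*} [AddCommGroup V] [Module k V]
  (ρ : Representation k G V) {K : Subgroup G} (v₀ : V) (hv₀ : v₀ ∈ invariants ρ K)

/-- **The cyclic submodule `⟨G v₀⟩`** generated by a `K`-invariant vector: the range of p8's `orbitLinear`
(`single (gK) c ↦ c • ρ(g) v₀`). -/
noncomputable def cyclicSpan : Submodule k V := LinearMap.range (orbitLinear ρ v₀ hv₀)

/-- `orbitLinear` is equivariant from the permutation representation on `k[G/K]`. -/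
theorem orbitLinear_equivariant (g : G) (x : MonoidAlgebra k (G ⧸ K)) :
    orbitLinear ρ v₀ hv₀ (Representation.ofMulAction k G (G ⧸ K) g x) = ρ g (orbitLinear ρ v₀ hv₀ x) :=
  (mem_equivariantHom_iff _ _).1 (orbitLinear_mem_equivariantHom ρ v₀ hv₀) g x

/-- `⟨G v₀⟩` is `G`-stable. -/
theorem apply_mem_cyclicSpan (g : G) {w : V} (hw : w ∈ cyclicSpan ρ v₀ hv₀) : ρ g w ∈ cyclicSpan ρ v₀ hv₀ := by
  obtain ⟨x, rfl⟩ := LinearMap.mem_range.1 hw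
  exact LinearMap.mem_range.2 ⟨Representation.ofMulAction k G (G ⧸ K) g x, orbitLinear_equivariant ρ v₀ hv₀ g x⟩

/-- `v₀ ∈ ⟨G v₀⟩`. -/
theorem mem_cyclicSpan : v₀ ∈ cyclicSpan ρ v₀ hv₀ :=
  LinearMap.mem_range.2 ⟨MonoidAlgebra.single ((1 : G) : G ⧸ K) 1, orbitLinear_single_one ρ v₀ hv₀⟩

/-- `ρ(g) v₀ ∈ ⟨G v₀⟩`. -/
theorem apply_mem_cyclicSpan' (g : G) : ρ g v₀ ∈ cyclicSpan ρ v₀ hv₀ :=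
  apply_mem_cyclicSpan ρ v₀ hv₀ g (mem_cyclicSpan ρ v₀ hv₀)

/-- **`⟨G v₀⟩` is the smallest `G`-stable submodule containing `v₀`.** -/
theorem cyclicSpan_le {N : Submodule k V} (hN : ∀ (g : G) ⦃w : V⦄, w ∈ N → ρ g w ∈ N) (h0 : v₀ ∈ N) :
    cyclicSpan ρ v₀ hv₀ ≤ N := by
  rintro _ ⟨x, rfl⟩
  induction x using MonoidAlgebra.induction_linear with
  | zero => rw [map_zero]; exact N.zero_mem
  | add x y hx hy => rw [map_add]; exact N.add_mem hx hy
  | single m r =>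
    obtain ⟨g, rfl⟩ := QuotientGroup.mk_surjective m
    rw [orbitLinear_single, orbitMap_mk]
    exact N.smul_mem r (hN g h0)

/-- The cyclic subrepresentation `⟨G v₀⟩ ⊆ V`. -/
noncomputable def cyclicSub : Subrepresentation ρ where
  toSubmodule := cyclicSpan ρ v₀ hv₀
  apply_mem_toSubmodule g _ hw := apply_mem_cyclicSpan ρ v₀ hv₀ g hw

/-- **The representation of `G` on `⟨G v₀⟩`.** -/
@[reducible] noncomputable def cyclicRep : Representation k G (cyclicSpan ρ v₀ hv₀) :=
  (cyclicSub ρ v₀ hv₀).toRepresentation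

/-- The action on `⟨G v₀⟩` is the restriction of `ρ`. -/
theorem coe_cyclicRep_apply (g : G) (w : cyclicSpan ρ v₀ hv₀) :
    ((cyclicRep ρ v₀ hv₀ g w : cyclicSpan ρ v₀ hv₀) : V) = ρ g (w : V) := rfl

/-- **The generator** `v₀` as an element of `⟨G v₀⟩`. -/
noncomputable def gen : cyclicSpan ρ v₀ hv₀ := ⟨v₀, mem_cyclicSpan ρ v₀ hv₀⟩

/-- `(gen : V) = v₀`. -/
theorem coe_gen : (gen ρ v₀ hv₀ : V) = v₀ := rfl

/-- The generator is `K`-invariant in `⟨G v₀⟩`. -/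
theorem gen_mem_invariants : gen ρ v₀ hv₀ ∈ invariants (cyclicRep ρ v₀ hv₀) K := by
  rw [mem_invariants_iff]
  intro κ hκ
  apply Subtype.ext
  rw [coe_cyclicRep_apply, coe_gen]
  exact (mem_invariants_iff.1 hv₀) κ hκ

/-- `gen ≠ 0` when `v₀ ≠ 0`. -/
theorem gen_ne_zero (h0 : v₀ ≠ 0) : gen ρ v₀ hv₀ ≠ 0 := fun h => h0 (congrArg Subtype.val h)

/-- Stabilisers in `⟨G v₀⟩` are stabilisers in `V`. -/
theorem stabilizerIn_cyclicRep (w : cyclicSpan ρ v₀ hv₀) :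
    stabilizerIn (cyclicRep ρ v₀ hv₀) K w = stabilizerIn ρ K (w : V) := by
  ext κ
  rw [mem_stabilizerIn_iff, mem_stabilizerIn_iff, ← Subtype.coe_inj, coe_cyclicRep_apply]

/-- **`⟨G v₀⟩` is `K`-finite**: it is the image of p8's `K`-finite permutation module `k[G/K]`
(`kFinite_ofMulAction`), and stabilisers only grow along equivariant maps (`stabilizerIn_le_map`). -/
theorem kFinite_cyclicRep (hfin : ∀ g : G, Finite (MulAction.orbit K (g : G ⧸ K))) :
    KFinite (cyclicRep ρ v₀ hv₀) K := by
  intro w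
  rw [stabilizerIn_cyclicRep]
  obtain ⟨x, hx⟩ := LinearMap.mem_range.1 w.2
  rw [← hx]
  haveI : (stabilizerIn (Representation.ofMulAction k G (G ⧸ K)) K x).FiniteIndex :=
    kFinite_ofMulAction (k := k) hfin x
  exact Subgroup.finiteIndex_of_le (stabilizerIn_le_map (orbitLinear_equivariant ρ v₀ hv₀) K x)

/-- **A `G`-stable subspace of `⟨G v₀⟩` containing the generator is everything.** -/
theorem eq_top_of_gen_mem {N : Submodule k (cyclicSpan ρ v₀ hv₀)}
    (hN : ∀ (g : G) ⦃w : cyclicSpan ρ v₀ hv₀⦄, w ∈ N → cyclicRep ρ v₀ hv₀ g w ∈ N)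
    (hgen : gen ρ v₀ hv₀ ∈ N) : N = ⊤ := by
  rw [eq_top_iff]
  rintro ⟨w, hw⟩ -
  have hle : cyclicSpan ρ v₀ hv₀ ≤ N.map (cyclicSpan ρ v₀ hv₀).subtype := by
    refine cyclicSpan_le ρ v₀ hv₀ (fun g w' hw' => ?_) ⟨gen ρ v₀ hv₀, hgen, rfl⟩
    obtain ⟨w'', hw'', rfl⟩ := Submodule.mem_map.1 hw'
    exact Submodule.mem_map.2 ⟨cyclicRep ρ v₀ hv₀ g w'', hN g hw'', rfl⟩
  obtain ⟨w', hw', hww⟩ := Submodule.mem_map.1 (hle hw)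
  have : (⟨w, hw⟩ : cyclicSpan ρ v₀ hv₀) = w' := Subtype.ext hww.symm
  exact this ▸ hw'

/-- **A maximal `G`-stable subspace of `⟨G v₀⟩` not containing `v₀` exists** (Zorn's lemma on the
`G`-stable subspaces missing the generator; the union of a chain is again such a subspace). -/
theorem exists_maximal (h0 : v₀ ≠ 0) : ∃ M : Submodule k (cyclicSpan ρ v₀ hv₀),
    (∀ (g : G) ⦃w : cyclicSpan ρ v₀ hv₀⦄, w ∈ M → cyclicRep ρ v₀ hv₀ g w ∈ M) ∧ gen ρ v₀ hv₀ ∉ M ∧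
      ∀ N : Submodule k (cyclicSpan ρ v₀ hv₀),
        (∀ (g : G) ⦃w : cyclicSpan ρ v₀ hv₀⦄, w ∈ N → cyclicRep ρ v₀ hv₀ g w ∈ N) →
          gen ρ v₀ hv₀ ∉ N → M ≤ N → N = M := by
  let S : Set (Submodule k (cyclicSpan ρ v₀ hv₀)) :=
    {N | (∀ (g : G) ⦃w : cyclicSpan ρ v₀ hv₀⦄, w ∈ N → cyclicRep ρ v₀ hv₀ g w ∈ N) ∧ gen ρ v₀ hv₀ ∉ N}
  have hbot : (⊥ : Submodule k (cyclicSpan ρ v₀ hv₀)) ∈ S := by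
    refine ⟨fun g w hw => ?_, fun h => gen_ne_zero ρ v₀ hv₀ h0 ((Submodule.mem_bot k).1 h)⟩
    rw [Submodule.mem_bot] at hw ⊢
    rw [hw, map_zero]
  have hchain : ∀ c ⊆ S, IsChain (· ≤ ·) c → ∀ y ∈ c, ∃ ub ∈ S, ∀ z ∈ c, z ≤ ub := by
    intro c hcS hc y hy
    refine ⟨sSup c, ⟨fun g w hw => ?_, fun hgen => ?_⟩, fun z hz => le_sSup hz⟩
    · rw [Submodule.mem_sSup_of_directed ⟨y, hy⟩ hc.directedOn] at hw ⊢
      obtain ⟨N, hNc, hwN⟩ := hw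
      exact ⟨N, hNc, (hcS hNc).1 g hwN⟩
    · rw [Submodule.mem_sSup_of_directed ⟨y, hy⟩ hc.directedOn] at hgen
      obtain ⟨N, hNc, hgN⟩ := hgen
      exact (hcS hNc).2 hgN
  obtain ⟨M, -, hM⟩ := zorn_le_nonempty₀ S hchain ⊥ hbot
  exact ⟨M, hM.prop.1, hM.prop.2, fun N hN hgen hMN => le_antisymm (hM.le_of_ge ⟨hN, hgen⟩ hMN) hMN⟩

/-- **A chosen maximal `G`-stable subspace of `⟨G v₀⟩` not containing `v₀`.** -/
noncomputable def maximalSub (h0 : v₀ ≠ 0) : Submodule k (cyclicSpan ρ v₀ hv₀) :=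
  Classical.choose (exists_maximal ρ v₀ hv₀ h0)

/-- `maximalSub` is `G`-stable. -/
theorem maximalSub_stable (h0 : v₀ ≠ 0) :
    ∀ (g : G) ⦃w : cyclicSpan ρ v₀ hv₀⦄, w ∈ maximalSub ρ v₀ hv₀ h0 →
      cyclicRep ρ v₀ hv₀ g w ∈ maximalSub ρ v₀ hv₀ h0 :=
  (Classical.choose_spec (exists_maximal ρ v₀ hv₀ h0)).1

/-- `v₀ ∉ maximalSub`. -/
theorem gen_notMem_maximalSub (h0 : v₀ ≠ 0) : gen ρ v₀ hv₀ ∉ maximalSub ρ v₀ hv₀ h0 :=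
  (Classical.choose_spec (exists_maximal ρ v₀ hv₀ h0)).2.1

/-- `maximalSub` is maximal among the `G`-stable subspaces missing `v₀`. -/
theorem eq_maximalSub_of_le (h0 : v₀ ≠ 0) {N : Submodule k (cyclicSpan ρ v₀ hv₀)}
    (hN : ∀ (g : G) ⦃w : cyclicSpan ρ v₀ hv₀⦄, w ∈ N → cyclicRep ρ v₀ hv₀ g w ∈ N)
    (hgen : gen ρ v₀ hv₀ ∉ N) (hle : maximalSub ρ v₀ hv₀ h0 ≤ N) : N = maximalSub ρ v₀ hv₀ h0 :=
  (Classical.choose_spec (exists_maximal ρ v₀ hv₀ h0)).2.2 N hN hgen hle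

/-- **The spherical subquotient** `⟨G v₀⟩ / maximalSub`, as a representation of `G`. -/
@[reducible] noncomputable def sphericalQuot (h0 : v₀ ≠ 0) :
    Representation k G (cyclicSpan ρ v₀ hv₀ ⧸ maximalSub ρ v₀ hv₀ h0) :=
  quotientBySub (cyclicRep ρ v₀ hv₀) (maximalSub ρ v₀ hv₀ h0) (maximalSub_stable ρ v₀ hv₀ h0)

/-- The image of the generator in the subquotient is non-zero. -/
theorem mk_gen_ne_zero (h0 : v₀ ≠ 0) :
    (Submodule.Quotient.mk (gen ρ v₀ hv₀) : cyclicSpan ρ v₀ hv₀ ⧸ maximalSub ρ v₀ hv₀ h0) ≠ 0 :=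
  fun h => gen_notMem_maximalSub ρ v₀ hv₀ h0 ((Submodule.Quotient.mk_eq_zero _).1 h)

/-- **THE SPHERICAL SUBQUOTIENT IS IRREDUCIBLE**: a subrepresentation of the quotient pulls back to a
`G`-stable subspace of `⟨G v₀⟩` containing `maximalSub`, hence equal to it (if it misses `v₀`) or to
everything (if it contains `v₀`, by `eq_top_of_gen_mem`). -/
theorem isIrreducible_sphericalQuot (h0 : v₀ ≠ 0) : (sphericalQuot ρ v₀ hv₀ h0).IsIrreducible := by
  have hb : ((⊥ : Subrepresentation (sphericalQuot ρ v₀ hv₀ h0)).toSubmodule) = ⊥ := rfl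
  have ht : ((⊤ : Subrepresentation (sphericalQuot ρ v₀ hv₀ h0)).toSubmodule) = ⊤ := rfl
  refine { exists_pair_ne := ⟨⊥, ⊤, fun h => ?_⟩, eq_bot_or_eq_top := fun P => ?_ }
  · have h' := congrArg Subrepresentation.toSubmodule h
    rw [hb, ht] at h'
    have hmem : (Submodule.Quotient.mk (gen ρ v₀ hv₀) : cyclicSpan ρ v₀ hv₀ ⧸ maximalSub ρ v₀ hv₀ h0) ∈
        (⊤ : Submodule k (cyclicSpan ρ v₀ hv₀ ⧸ maximalSub ρ v₀ hv₀ h0)) := Submodule.mem_top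
    rw [← h', Submodule.mem_bot] at hmem
    exact mk_gen_ne_zero ρ v₀ hv₀ h0 hmem
  · set N : Submodule k (cyclicSpan ρ v₀ hv₀) := P.toSubmodule.comap (maximalSub ρ v₀ hv₀ h0).mkQ with hNdef
    have hNst : ∀ (g : G) ⦃w : cyclicSpan ρ v₀ hv₀⦄, w ∈ N → cyclicRep ρ v₀ hv₀ g w ∈ N := by
      intro g w hw
      rw [hNdef, Submodule.mem_comap] at hw ⊢
      rw [mkQ_equivariant (cyclicRep ρ v₀ hv₀) (maximalSub ρ v₀ hv₀ h0) (maximalSub_stable ρ v₀ hv₀ h0)]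
      exact P.apply_mem_toSubmodule g hw
    have hMN : maximalSub ρ v₀ hv₀ h0 ≤ N := by
      intro w hw
      rw [hNdef, Submodule.mem_comap, Submodule.mkQ_apply, (Submodule.Quotient.mk_eq_zero _).2 hw]
      exact P.toSubmodule.zero_mem
    have hP : P.toSubmodule = N.map (maximalSub ρ v₀ hv₀ h0).mkQ :=
      (Submodule.map_comap_eq_of_surjective (maximalSub ρ v₀ hv₀ h0).mkQ_surjective P.toSubmodule).symm
    by_cases hgen : gen ρ v₀ hv₀ ∈ N
    · right
      apply Subrepresentation.toSubmodule_injective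
      rw [ht, hP, eq_top_of_gen_mem ρ v₀ hv₀ hNst hgen, Submodule.map_top, Submodule.range_mkQ]
    · left
      apply Subrepresentation.toSubmodule_injective
      rw [hb, hP, eq_maximalSub_of_le ρ v₀ hv₀ h0 hNst hgen hMN, Submodule.mkQ_map_self]

/-- **The spherical subquotient is `K`-finite.** -/
theorem kFinite_sphericalQuot (hfin : ∀ g : G, Finite (MulAction.orbit K (g : G ⧸ K))) (h0 : v₀ ≠ 0) :
    KFinite (sphericalQuot ρ v₀ hv₀ h0) K :=
  kFinite_quotientRep (cyclicRep ρ v₀ hv₀) (kFinite_cyclicRep ρ v₀ hv₀ hfin) (maximalSub ρ v₀ hv₀ h0)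
    (maximalSub_stable ρ v₀ hv₀ h0)

/-- The image of the generator is `K`-invariant in the subquotient. -/
theorem mk_gen_mem_invariants (h0 : v₀ ≠ 0) :
    (Submodule.Quotient.mk (gen ρ v₀ hv₀) : cyclicSpan ρ v₀ hv₀ ⧸ maximalSub ρ v₀ hv₀ h0) ∈
      invariants (sphericalQuot ρ v₀ hv₀ h0) K := by
  rw [mem_invariants_iff]
  intro κ hκ
  rw [quotientRep_mk]
  congr 1
  exact (mem_invariants_iff.1 (gen_mem_invariants ρ v₀ hv₀)) κ hκ

/-- The `K`-invariants of the subquotient are non-zero. -/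
theorem invariants_sphericalQuot_ne_bot (h0 : v₀ ≠ 0) : invariants (sphericalQuot ρ v₀ hv₀ h0) K ≠ ⊥ :=
  fun h => mk_gen_ne_zero ρ v₀ hv₀ h0 ((Submodule.mem_bot k).1 (h ▸ mk_gen_mem_invariants ρ v₀ hv₀ h0))

/-- **The Hecke action on the generator descends to `⟨G v₀⟩`**: `T · v₀ = c • v₀` in `V` gives the same in
`⟨G v₀⟩` (the inclusion is an injective equivariant map). -/
theorem heckeSMul_cyclicRep_gen (T : heckeAlgebra k K) {c : k}
    (hT : heckeSMul ρ T ⟨v₀, hv₀⟩ = c • ⟨v₀, hv₀⟩) :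
    heckeSMul (cyclicRep ρ v₀ hv₀) T ⟨gen ρ v₀ hv₀, gen_mem_invariants ρ v₀ hv₀⟩ =
      c • ⟨gen ρ v₀ hv₀, gen_mem_invariants ρ v₀ hv₀⟩ := by
  have hι : ∀ (g : G) (w : cyclicSpan ρ v₀ hv₀),
      (cyclicSpan ρ v₀ hv₀).subtype (cyclicRep ρ v₀ hv₀ g w) = ρ g ((cyclicSpan ρ v₀ hv₀).subtype w) :=
    fun _ _ => rfl
  apply invariantsMap_injective hι K (Submodule.injective_subtype _)
  rw [invariantsMap_heckeSMul, map_smul]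
  have e : invariantsMap (cyclicSpan ρ v₀ hv₀).subtype hι K ⟨gen ρ v₀ hv₀, gen_mem_invariants ρ v₀ hv₀⟩ =
      ⟨v₀, hv₀⟩ := Subtype.ext (by rw [invariantsMap_apply]; rfl)
  rw [e, hT]

/-- The class of `[v₀]` in the `K`-invariants is non-zero. -/
theorem mk_gen_invariants_ne_zero (h0 : v₀ ≠ 0) :
    (⟨Submodule.Quotient.mk (gen ρ v₀ hv₀), mk_gen_mem_invariants ρ v₀ hv₀ h0⟩ :
      invariants (sphericalQuot ρ v₀ hv₀ h0) K) ≠ 0 :=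
  fun h => mk_gen_ne_zero ρ v₀ hv₀ h0 (congrArg Subtype.val h)

/-- **The Hecke action on `[v₀]` in the spherical subquotient**: `T · v₀ = c • v₀` gives `T · [v₀] = c • [v₀]`
(the projection is an equivariant map, `invariantsMap_heckeSMul`). -/
theorem heckeSMul_sphericalQuot_mk_gen (h0 : v₀ ≠ 0) (T : heckeAlgebra k K) {c : k}
    (hT : heckeSMul ρ T ⟨v₀, hv₀⟩ = c • ⟨v₀, hv₀⟩) :
    heckeSMul (sphericalQuot ρ v₀ hv₀ h0) T
        ⟨Submodule.Quotient.mk (gen ρ v₀ hv₀), mk_gen_mem_invariants ρ v₀ hv₀ h0⟩ =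
      c • ⟨Submodule.Quotient.mk (gen ρ v₀ hv₀), mk_gen_mem_invariants ρ v₀ hv₀ h0⟩ := by
  have hq := mkQ_equivariant (cyclicRep ρ v₀ hv₀) (maximalSub ρ v₀ hv₀ h0) (maximalSub_stable ρ v₀ hv₀ h0)
  have e : invariantsMap (σ := sphericalQuot ρ v₀ hv₀ h0) (maximalSub ρ v₀ hv₀ h0).mkQ hq K
      ⟨gen ρ v₀ hv₀, gen_mem_invariants ρ v₀ hv₀⟩ =
        ⟨Submodule.Quotient.mk (gen ρ v₀ hv₀), mk_gen_mem_invariants ρ v₀ hv₀ h0⟩ :=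
    Subtype.ext (by rw [invariantsMap_apply, Submodule.mkQ_apply])
  rw [← e, ← invariantsMap_heckeSMul, heckeSMul_cyclicRep_gen ρ v₀ hv₀ T hT, map_smul]

variable [CharZero k]

/-- **THE `K`-INVARIANTS OF THE SPHERICAL SUBQUOTIENT ARE THE LINE THROUGH `[v₀]`**, provided every
`K`-invariant vector of `⟨G v₀⟩` is a multiple of `v₀`: a `K`-invariant vector of the quotient is its own
level average, which is the image of the level average of any lift (`map_levelAverage'`), a `K`-invariant
vector of `⟨G v₀⟩`. -/
theorem invariants_sphericalQuot_eq (hfin : ∀ g : G, Finite (MulAction.orbit K (g : G ⧸ K))) (h0 : v₀ ≠ 0)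
    (hC : ∀ w ∈ cyclicSpan ρ v₀ hv₀, w ∈ invariants ρ K → ∃ a : k, w = a • v₀) :
    invariants (sphericalQuot ρ v₀ hv₀ h0) K =
      k ∙ (Submodule.Quotient.mk (gen ρ v₀ hv₀) : cyclicSpan ρ v₀ hv₀ ⧸ maximalSub ρ v₀ hv₀ h0) := by
  apply le_antisymm
  · intro x hx
    obtain ⟨w, rfl⟩ := Submodule.Quotient.mk_surjective _ x
    have hK := kFinite_cyclicRep ρ v₀ hv₀ hfin
    haveI := hK w
    have h1 : levelAverage (sphericalQuot ρ v₀ hv₀ h0) K (Submodule.Quotient.mk w) =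
        Submodule.Quotient.mk w := levelAverage_of_mem_invariants hx
    have h2 := map_levelAverage' (σ := sphericalQuot ρ v₀ hv₀ h0) (f := (maximalSub ρ v₀ hv₀ h0).mkQ)
      (mkQ_equivariant (cyclicRep ρ v₀ hv₀) (maximalSub ρ v₀ hv₀ h0) (maximalSub_stable ρ v₀ hv₀ h0)) hK w
    have h3 : levelAverage (cyclicRep ρ v₀ hv₀) K w ∈ invariants (cyclicRep ρ v₀ hv₀) K :=
      levelAverage_mem_invariants
    have h4 : ((levelAverage (cyclicRep ρ v₀ hv₀) K w : cyclicSpan ρ v₀ hv₀) : V) ∈ invariants ρ K := by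
      rw [mem_invariants_iff] at h3 ⊢
      intro κ hκ
      rw [← coe_cyclicRep_apply, h3 κ hκ]
    obtain ⟨a, ha⟩ := hC _ (levelAverage (cyclicRep ρ v₀ hv₀) K w).2 h4
    have h5 : levelAverage (cyclicRep ρ v₀ hv₀) K w = a • gen ρ v₀ hv₀ := Subtype.ext ha
    rw [Submodule.mem_span_singleton]
    refine ⟨a, ?_⟩
    calc a • (Submodule.Quotient.mk (gen ρ v₀ hv₀) : cyclicSpan ρ v₀ hv₀ ⧸ maximalSub ρ v₀ hv₀ h0)
        = (maximalSub ρ v₀ hv₀ h0).mkQ (a • gen ρ v₀ hv₀) := by rw [map_smul, Submodule.mkQ_apply]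
      _ = (maximalSub ρ v₀ hv₀ h0).mkQ (levelAverage (cyclicRep ρ v₀ hv₀) K w) := by rw [h5]
      _ = levelAverage (sphericalQuot ρ v₀ hv₀ h0) K ((maximalSub ρ v₀ hv₀ h0).mkQ w) := h2
      _ = Submodule.Quotient.mk w := by rw [Submodule.mkQ_apply, h1]
  · rw [Submodule.span_le, Set.singleton_subset_iff]
    exact mk_gen_mem_invariants ρ v₀ hv₀ h0

/-- The `K`-invariants of the subquotient are finite-dimensional (one-dimensional). -/
theorem finiteDimensional_invariants_sphericalQuot (hfin : ∀ g : G, Finite (MulAction.orbit K (g : G ⧸ K)))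
    (h0 : v₀ ≠ 0) (hC : ∀ w ∈ cyclicSpan ρ v₀ hv₀, w ∈ invariants ρ K → ∃ a : k, w = a • v₀) :
    FiniteDimensional k (invariants (sphericalQuot ρ v₀ hv₀ h0) K) := by
  rw [invariants_sphericalQuot_eq ρ v₀ hv₀ hfin h0 hC]
  infer_instance

/-- **THE HECKE CHARACTER OF THE SPHERICAL SUBQUOTIENT IS READ OFF `v₀`**: for a commutative Hecke algebra
and `k` algebraically closed, `T · v₀ = c • v₀` in `V` forces `χ_{⟨G v₀⟩ / maximalSub}(T) = c`. -/
theorem heckeCharacter_sphericalQuot [IsAlgClosed k] (hfin : ∀ g : G, Finite (MulAction.orbit K (g : G ⧸ K)))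
    (h0 : v₀ ≠ 0) (hC : ∀ w ∈ cyclicSpan ρ v₀ hv₀, w ∈ invariants ρ K → ∃ a : k, w = a • v₀)
    (hcomm : ∀ T S : heckeAlgebra k K, T * S = S * T) (T : heckeAlgebra k K) {c : k}
    (hT : heckeSMul ρ T ⟨v₀, hv₀⟩ = c • ⟨v₀, hv₀⟩) :
    haveI := isIrreducible_sphericalQuot ρ v₀ hv₀ h0
    haveI := finiteDimensional_invariants_sphericalQuot ρ v₀ hv₀ hfin h0 hC
    heckeCharacter (sphericalQuot ρ v₀ hv₀ h0) (kFinite_sphericalQuot ρ v₀ hv₀ hfin h0) hfin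
      (invariants_sphericalQuot_ne_bot ρ v₀ hv₀ h0) hcomm T = c := by
  haveI := isIrreducible_sphericalQuot ρ v₀ hv₀ h0
  haveI := finiteDimensional_invariants_sphericalQuot ρ v₀ hv₀ hfin h0 hC
  exact heckeCharacter_eq_of_smul_eq _ _ _ _ _ (mk_gen_invariants_ne_zero ρ v₀ hv₀ h0)
    (heckeSMul_sphericalQuot_mk_gen ρ v₀ hv₀ h0 T hT)

end Cyclic

end Summit.Ventures.HodgeRepro2.T5CyclicSubquotient
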